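import Literature.AnabelianGeometry.EtaleTheta.SettingModelTateProp15iii
import Literature.AnabelianGeometry.EtaleTheta.SettingModelTateAnchoredPoints
import Literature.AnabelianGeometry.EtaleTheta.SettingModelTateMuTwo
import Literature.AnabelianGeometry.EtaleTheta.SettingModelTateProp15
import Literature.AnabelianGeometry.EtaleTheta.SettingModelTateOrigin
import Literature.AnabelianGeometry.EtaleTheta.Discharge.Sec1Thm110ModelChiDeck
import Literature.AnabelianGeometry.EtaleTheta.Discharge.Sec1Thm110iUniqueDeck
import Literature.AnabelianGeometry.EtaleTheta.Discharge.Sec1Prop15OfYCoordKit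
import HarnessLib

/-!
# [EtTh] Def. 1.9 / Thm. 1.10 at the STAGE-2 («Tate shear») model: the K2 closers INHABITED at
# `MuTwoSetting.modelχq p 1 2` TOGETHER WITH Prop. 1.5 (iii) — and Thm. 1.10 (i)-uniqueness by the printed route

S. Mochizuki, *The étale theta function and its Frobenioid-theoretic manifestations*, Publ. RIMS **45** (2009) [EtTh],
§1: Def. 1.7 p. 27 ("a nontrivial element `ε_Z ∈ Gal(Ẍ/X)` which is `≠ ε_μ`"), Def. 1.9 p. 29 (PRIMS p. 255: "suppose
that `√−1 ∈ K`"; "`√−1` determines a 4-torsion point `τ` … the 4-torsion point `τ⁻¹` determined by `−√−1` admits a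
similar description"), Prop. 1.5 (iii) p. 23, Thm. 1.10 (i)(ii) pp. 29–30 [cite: MochizukiEtTh2009, Thm 1.10 (i) p.29].
Layer L2 of the abc-iut cell, seat abc-iut-w5-d171 (gen 4; R78 Kummer lineage), row «K2-NV @ STAGE 2» (self-named,
abc-iut-L2-lead gen 4 CLAIMS fold 12:4xZ; first refusal abc-iut-w5-d140 / abc-iut-L2-t12 / abc-iut-f-113 ran silent).

PROOF-ONLY apart from five `abbrev`s naming stage-2 terms (no new structure, no instance, no notation, no `Prop` fact),
over — all consumed BY NAME, nothing restated —: abc-iut-w5-d249's F4q-C `MuTwoSetting.modelχq p i j hj` (the Def. 1.7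
record over abc-iut-L2-t5's `ThetaSetting.modelχq`; `Π^tp_Ẍ = Ker(parity)`, `ε_μ = b`), abc-iut-L2-t6's F7q
(`anchoredPointχqOfSection`, `sectionOfUnitχq`, `kappaUnitχq`, `sectionχq`, `etaDdχq`,
`prop15iii_etaleThetaDataOfClass_etaDdχq`, `mem_GtpYdd_modelχq_of_hHat_two_y`), this lineage's F6q (`kummerCoreχq`,
`yCoordKitχq`), abc-iut-L6-d5's `exists_res_eq_logTheta_gtpY_modelχq` + kit assembly
`KummerCore.prop15i_and_prop15ii_ofSection_of_kit`, abc-iut-w5-d140's K2-NV at stage 1 (`sqrtNegOneχ`,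
`sqrtNegOneUnitχ`, `sqrtNegOneInvUnitχ`, `…_ne_cusp`, **`exists_deck_exponent`**, `inl_gfpOf_zero_not_mem_Xddχ`,
`inl_gfpOf_zero_mul_inv_not_mem_Xddχ`) and its K2 closers `MuTwoSetting.thm110i_and_ii_refl` (p429827) and r8″
`MuTwoSetting.thm110iUnique_anchored_of_deck` (p425484), abc-iut-w5-d051's `modelχq_isTateOrigin`.

WHY STAGE 2. At the split stage-1 model `modelχ` the K2 closers for Thm. 1.10 (i)(ii) were inhabited (abc-iut-w5-d140,
`Sec1Thm110ModelChiNV` / `…Deck`), but the typed Prop. 1.5 (iii) (`Prop15iii`, FACT-LIST F-0591) is FALSE there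
(abc-iut-L2-t12), so the r8″ route to Thm. 1.10 (i)-UNIQUENESS (F-0513) — whose binders are `Prop15ii`, `Prop15iii` and
the deck relation — could not be exercised at any model. At `modelχq p 1 2` Prop. 1.5 (iii) HOLDS (abc-iut-L2-t6,
p444321 ✓). THIS FILE shows that every OTHER K2 binder transports to stage 2 unchanged — the `b`-axis algebra is
stage-independent (`actχq σ (b^t) = b^{χ(σ)t}`), `K̈(modelχq) = K̈(modelχ) = ℚ_p`, the Kummer cocycles `κ_u` coincide
definitionally (`kappaUnitχq p 1 2 _ u = kappaUnitχ p u`), and `Π^tp_Ẍ` is cut out by the same parity of `Γ` — so: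

* `epsZχq`, **`modelχq_isAdmissibleEpsZ`**: `ε_Z := a` is admissible at stage 2 (Def. 1.7);
* `kummerDataχqInr` (the section Kummer datum along the Galois factor `inr`), `etaleThetaDataχqInr` (its étale-theta
  datum with `η̈^Θ := etaDdχq`), **`prop15i_and_ii_kummerDataχqInr`** (kit assembly, inline) and `prop15iii_…` (F7q);
* `tauχq` / `tauInvχq` := abc-iut-L2-t6's anchored points with coordinates `√−1^{±1}` (`p ≡ 1 (mod 4)`),
  **`anchoredStandardDataχq`** (Def. 1.9's anchored standard datum at stage 2);
* **`exists_deck_modelχq`**: the deck element `ε := b^t` — the SAME exponent `t` as at stage 1 — realises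
  `D_{τ⁻¹} = ε⁻¹·D_τ·ε` with `toZ ε = 1` (degree `0`);
* **`modelχq_thm110i_and_ii`** (γ = id, p429827) and — NEW, impossible at stage 1 — **`modelχq_thm110iUnique`**:
  the r8″ closer INSTANTIATED with `Prop15ii`, `Prop15iii` and the deck relation ALL THEOREMS; census headline
  `MuTwoSetting.exists_stage2_model_thm110_with_prop15iii`: at ONE Def. 1.7 setting satisfying `IsEtThOrigin` and the
  Tate clause `IsTateOrigin`, with an admissible `ε_Z`, an étale-theta datum `E`, an anchored standard datum `A`:
  `Prop15i ∧ Prop15ii ∧ Prop15iii ∧ deck ∧ Thm110i ∧ Thm110ii ∧ Thm110iUnique`.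

HONEST FRAMING: SEMI-SYNTHETIC model (the Tate-sheared χ-twisted root; not the tempered `π₁` of a curve) — joint
non-vacuity / consistency evidence for the typed interface ONLY; `γ = id`; the values at section-points are not the
printed `Θ̈(√−1)`; nothing of [EtTh] is asserted; a FACT row is an assumption label; typed ≠ proved; no side is taken
on [IUTchIII] Cor. 3.12.
-/

noncomputable section

namespace Literature.AnabelianGeometry.EtaleTheta.SettingModel

open Literature.AnabelianGeometry.SemiGraphs Literature.AnabelianGeometry.AbsoluteAnabelian
open _root_.Topology _root_.Function

variable (p : ℕ) [Fact p.Prime]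

/-! ### §1. The Galois factor `inr` as a section of the Tate instance `modelχq p 1 2` -/

/-- `inr(G_K) ≤ Π^tp_Y` at `modelχq p 1 2` (degree `0`). [cite: MochizukiEtTh2009, §1 p.12] -/
theorem inr_map_GK_le_GtpY_tate :
    (ThetaSetting.modelχq p 1 2 even_two).GK.map
        (SemidirectProduct.inr : GQp p →* (ThetaSetting.modelχq p 1 2 even_two).PiTemp) ≤
      (ThetaSetting.modelχq p 1 2 even_two).GtpY := by
  rintro _ ⟨σ, -, rfl⟩
  show (tateTwistData₀ p 1 2).toZ _ = 1
  rw [GfpTwistData₀.toZ_apply, SemidirectProduct.left_inr, map_one]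

/-- `inr(G_K̈) ≤ Π^tp_Ÿ` at `modelχq p 1 2` (`K_2 = J̈_1 = ℚ_p`; trivial `Γ`-part). [cite: MochizukiEtTh2009, §1 p.17] -/
theorem inr_map_GKdd_le_GtpYdd_tate :
    (ThetaSetting.modelχq p 1 2 even_two).GKdd.map
        (SemidirectProduct.inr : GQp p →* (ThetaSetting.modelχq p 1 2 even_two).PiTemp) ≤
      (ThetaSetting.modelχq p 1 2 even_two).GtpYdd := by
  rintro _ ⟨σ, -, rfl⟩
  refine mem_GtpYdd_modelχq_of_hHat_two_y p 1 2 even_two ?_ ?_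
  · show (tateTwistData₀ p 1 2).toZ _ = 1
    rw [GfpTwistData₀.toZ_apply, SemidirectProduct.left_inr, map_one]
  · rw [SemidirectProduct.left_inr, map_one, map_one]
    rfl

/-- **The section Kummer datum along `inr`** of the Tate instance (abc-iut-L2-t6's F7q datum; the stage-2 core is this
lineage's `kummerCoreχq`). NAMED here once. [cite: MochizukiEtTh2009, Prop 1.5 p.23] -/
abbrev kummerDataχqInr : (ThetaSetting.modelχq p 1 2 even_two).KummerData :=
  (kummerCoreχq p 1 2 even_two).toKummerDataOfSection (SemidirectProduct.inr : GQp p →* PiTpχq p 1 2)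
    (continuous_inrχq p 1 2) (fun _ => rfl) (inr_map_GK_le_GtpY_tate p) (inr_map_GKdd_le_GtpYdd_tate p)

/-- **Its étale-theta datum carrying `η̈^Θ := etaDdχq`** (abc-iut-L2-t6's `z`-class of the Tate instance), read as data of
the Def. 1.7 record `MuTwoSetting.modelχq p 1 2` (whose theta setting IS `ThetaSetting.modelχq p 1 2`).
[cite: MochizukiEtTh2009, Prop 1.5 (iii) p.23] -/
abbrev etaleThetaDataχqInr : (MuTwoSetting.modelχq p 1 2 even_two).toThetaSetting.EtaleThetaData :=
  (kummerDataχqInr p).etaleThetaDataOfClass (etaDdχq p 1 2 even_two)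

/-! ### §2. Prop. 1.5 (i), (ii), (iii) at this ONE datum -/

/-- **Prop. 1.5 (i) ∧ (ii) for the `inr`-section datum of the Tate instance** (abc-iut-L6-d5's route, inline: the kit
`yCoordKitχq` reproduces the core's classes on the nose, `ŷ` dies on `Δ_Θ`, the `z`-lift closes clause (a)).
[cite: MochizukiEtTh2009, Prop 1.5 (ii) p.23] -/
theorem prop15i_and_ii_kummerDataχqInr (hC : (ThetaSetting.modelχq p 1 2 even_two).Compat) :
    ThetaSetting.Prop15i (kummerDataχqInr p) hC ∧ ThetaSetting.Prop15ii (kummerDataχqInr p) hC := by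
  haveI : T2Space (ThetaSetting.modelχq p 1 2 even_two).GtpTheta := CurveTheta.t2Space_GTheta (curveχq p 1 2)
  obtain ⟨x, hx⟩ := exists_res_eq_logTheta_gtpY_modelχq p 1 2 even_two
    (hC.deltaTheta_le_DtpYTheta.trans (Subgroup.map_mono inf_le_left))
  exact (kummerCoreχq p 1 2 even_two).prop15i_and_prop15ii_ofSection_of_kit (yCoordKitχq p 1 2 even_two) _
    (continuous_inrχq p 1 2) (fun _ => rfl) (inr_map_GK_le_GtpY_tate p) (inr_map_GKdd_le_GtpYdd_tate p) hC rfl rfl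
    (fun d hd => yThetaχq_eq_one_of_mem_deltaTheta p 1 2 hd) x hx

/-- **Prop. 1.5 (ii)** for the étale-theta datum's Kummer datum (same term). [cite: MochizukiEtTh2009, Prop 1.5 (ii) p.23] -/
theorem prop15ii_etaleThetaDataχqInr (hC : (ThetaSetting.modelχq p 1 2 even_two).Compat) :
    ThetaSetting.Prop15ii (etaleThetaDataχqInr p).toKummerData hC :=
  (prop15i_and_ii_kummerDataχqInr p hC).2

/-- **Prop. 1.5 (iii)** for the étale-theta datum (abc-iut-L2-t6's F7q capstone, p444321). [cite: MochizukiEtTh2009, Prop 1.5 (iii) p.23] -/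
theorem prop15iii_etaleThetaDataχqInr (hC : (ThetaSetting.modelχq p 1 2 even_two).Compat) :
    ThetaSetting.Prop15iii (etaleThetaDataχqInr p) hC :=
  prop15iii_etaleThetaDataOfClass_etaDdχq p hC _ _ _ _ _

/-! ### §3. Def. 1.7 at stage 2: the admissible `ε_Z := a` -/

/-- The choice `ε_Z := a` of the Tate instance, as an element of `Π^tp_C`. [cite: MochizukiEtTh2009, Def 1.7 p.27] -/
abbrev epsZχq : (MuTwoSetting.modelχq p 1 2 even_two).GtpC :=
  (MuTwoSetting.modelχq p 1 2 even_two).inclX (SemidirectProduct.inl (gfpOf (FreeGroup.of 0)))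

/-- **`ε_Z := a` is admissible at stage 2** ("a nontrivial element `ε_Z ∈ Gal(Ẍ/X)` which is `≠ ε_μ`"): `a ∉ Π^tp_Ẍ` and
`a·b⁻¹ ∉ Π^tp_Ẍ` — the parity of `Γ` cutting out `Π^tp_Ẍ` is the stage-1 one (abc-iut-f-113 / abc-iut-w5-d140, by
definitional unfolding). [cite: MochizukiEtTh2009, Def 1.7 p.27] -/
theorem modelχq_isAdmissibleEpsZ : (MuTwoSetting.modelχq p 1 2 even_two).IsAdmissibleEpsZ (epsZχq p) := by
  refine ⟨⟨_, rfl⟩, ?_, ?_⟩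
  · rintro ⟨y, hy, hyy⟩
    have h := SemidirectProduct.inl_injective hyy
    subst h
    exact inl_gfpOf_zero_not_mem_Xddχ p hy
  · rintro ⟨y, hy, hyy⟩
    -- `y = a · b⁻¹` in `Π^tp_X`
    change SemidirectProduct.inl y =
      SemidirectProduct.inl (SemidirectProduct.inl (gfpOf (FreeGroup.of 0)) : PiTpχq p 1 2) *
        (SemidirectProduct.inl (SemidirectProduct.inl (gfpOf (FreeGroup.of 1)) : PiTpχq p 1 2))⁻¹ at hyy
    rw [← map_inv, ← map_mul] at hyy
    have h' := SemidirectProduct.inl_injective hyy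
    subst h'
    -- the parity of `a · b⁻¹` is `(1, −1) ≠ 0` — abc-iut-f-113's stage-1 computation, read through the parity hom
    have key : xyTwo (gfpOf (FreeGroup.of 0)) * (xyTwo (gfpOf (FreeGroup.of 1)))⁻¹ ≠ 1 := by
      intro h
      apply inl_gfpOf_zero_mul_inv_not_mem_Xddχ p
      rw [Xddχ, MonoidHom.mem_ker, map_mul, map_inv, parityχ_inl, parityχ_inl]
      exact h
    apply key
    have hy' := MonoidHom.mem_ker.mp hy
    rwa [map_mul, map_inv, parityχq_apply, parityχq_apply, SemidirectProduct.left_inl,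
      SemidirectProduct.left_inl] at hy'

/-! ### §4. Def. 1.9 at stage 2: `τ^{±1}` and the anchored standard datum (`p ≡ 1 (mod 4)`) -/

/-- **`τ` at stage 2**: the anchored point of the `inr`-section datum at the `κ_{√−1}²`-twisted section, `Ü(τ) = √−1`
(abc-iut-L2-t6's `anchoredPointχqOfSection`; `K̈(modelχq) = K̈(modelχ)` so abc-iut-w5-d140's unit `√−1` serves).
[cite: MochizukiEtTh2009, Def 1.9 p.29] -/
abbrev tauχq (hp : p % 4 = 1) : ThetaSetting.AnchoredPoint (kummerDataχqInr p) :=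
  anchoredPointχqOfSection p 1 2 even_two _ (continuous_inrχq p 1 2) (fun _ => rfl) (inr_map_GK_le_GtpY_tate p)
    (inr_map_GKdd_le_GtpYdd_tate p) (sqrtNegOneUnitχ p hp) (sqrtNegOneUnitχ_ne_cusp p hp)

/-- **`τ⁻¹` at stage 2**, `Ü(τ⁻¹) = (√−1)⁻¹ = −√−1`. [cite: MochizukiEtTh2009, Def 1.9 p.29] -/
abbrev tauInvχq (hp : p % 4 = 1) : ThetaSetting.AnchoredPoint (kummerDataχqInr p) :=
  anchoredPointχqOfSection p 1 2 even_two _ (continuous_inrχq p 1 2) (fun _ => rfl) (inr_map_GK_le_GtpY_tate p)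
    (inr_map_GKdd_le_GtpYdd_tate p) (sqrtNegOneInvUnitχ p hp) (sqrtNegOneInvUnitχ_ne_cusp p hp)

/-- **Def. 1.9's anchored standard datum at the stage-2 Def. 1.7 record** (`√−1 ∈ K = ℚ_p`, `τ`, `τ⁻¹` as above), over
the étale-theta datum's Kummer datum. [cite: MochizukiEtTh2009, Def 1.9 p.29] -/
def anchoredStandardDataχq (hp : p % 4 = 1) :
    (MuTwoSetting.modelχq p 1 2 even_two).AnchoredStandardData (etaleThetaDataχqInr p).toKummerData :=
  MuTwoSetting.anchoredStandardDataOfPoints (sqrtNegOneχ p hp) (sqrtNegOneχ_mem_K p hp) (sqrtNegOneχ_sq p hp)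
    (tauχq p hp) (tauInvχq p hp) rfl rfl

/-- `D_τ = s_{√−1}(G_{ℚ_p})`. [cite: MochizukiEtTh2009, Def 1.9 p.29] -/
theorem anchoredStandardDataχq_tau_Dpt (hp : p % 4 = 1) :
    (anchoredStandardDataχq p hp).tau.Dpt =
      (ThetaSetting.modelχq p 1 2 even_two).GKdd.map (sectionOfUnitχq p 1 2 even_two (sqrtNegOneUnitχ p hp)) := rfl

/-- `D_{τ⁻¹} = s_{(√−1)⁻¹}(G_{ℚ_p})`. [cite: MochizukiEtTh2009, Def 1.9 p.29] -/
theorem anchoredStandardDataχq_tauInv_Dpt (hp : p % 4 = 1) :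
    (anchoredStandardDataχq p hp).tauInv.Dpt =
      (ThetaSetting.modelχq p 1 2 even_two).GKdd.map (sectionOfUnitχq p 1 2 even_two (sqrtNegOneInvUnitχ p hp)) := rfl

/-- **CENSUS: `AnchoredStandardData` / `StandardData` WITNESSED at the stage-2 record** for `p ≡ 1 (mod 4)`.
[cite: MochizukiEtTh2009, Def 1.9 p.29] -/
theorem nonempty_anchoredStandardData_modelχq (hp : p % 4 = 1) :
    Nonempty ((MuTwoSetting.modelχq p 1 2 even_two).AnchoredStandardData (etaleThetaDataχqInr p).toKummerData) ∧
      Nonempty ((MuTwoSetting.modelχq p 1 2 even_two).StandardData (etaleThetaDataχqInr p).toKummerData) :=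
  ⟨⟨anchoredStandardDataχq p hp⟩, ⟨(anchoredStandardDataχq p hp).toStandardData⟩⟩

/-! ### §5. The deck element `ε := b^t` at stage 2 — the SAME exponent as at stage 1 -/

/-- The stage-2 Kummer cocycle of a unit IS the stage-1 one (same `K̈`, same root system; definitional).
[cite: MochizukiEtTh2009, Prop 1.5 p.23] -/
theorem kappaUnitχq_tate_eq (u : (↥(ThetaSetting.modelχq p 1 2 even_two).Kdd)ˣ) :
    kappaUnitχq p 1 2 even_two u = kappaUnitχ p u := rfl

/-- Conjugating a stage-2 twisted section by `b^t`, `Γ`-component: `(b^t · ⟨b^{f σ}, σ⟩ · b^{−t}).left =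
b^{t · f σ · (χ(σ) t)⁻¹}` — the affine `actχq` fixes the `b`-axis up to `χ`. [cite: MochizukiEtTh2009, Def 1.9 p.29] -/
theorem inl_bPowGfp_conj_sectionχq_left (i j : ℤ) (t : ZH) (f : GQp p → ZH)
    (hf : ∀ σ τ : GQp p, f (σ * τ) = f σ * chi p σ (f τ)) (σ : GQp p) :
    ((SemidirectProduct.inl (bPowGfp t) : PiTpχq p i j) * sectionχq p i j f hf σ *
        (SemidirectProduct.inl (bPowGfp t))⁻¹).left =
      bPowGfp (t * f σ * (chi p σ t)⁻¹) := by
  simp only [SemidirectProduct.mul_left, SemidirectProduct.mul_right, SemidirectProduct.inv_left,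
    SemidirectProduct.left_inl, SemidirectProduct.right_inl, sectionχq_left, sectionχq_right, map_one,
    MulAut.one_apply, one_mul, inv_one, map_inv, map_mul, actχq_bPowGfp, cocyclePairHom_right]

/-- … and Galois component `σ`. [cite: MochizukiEtTh2009, Def 1.9 p.29] -/
theorem inl_bPowGfp_conj_sectionχq_right (i j : ℤ) (t : ZH) (f : GQp p → ZH)
    (hf : ∀ σ τ : GQp p, f (σ * τ) = f σ * chi p σ (f τ)) (σ : GQp p) :
    ((SemidirectProduct.inl (bPowGfp t) : PiTpχq p i j) * sectionχq p i j f hf σ *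
        (SemidirectProduct.inl (bPowGfp t))⁻¹).right = σ := by
  simp only [SemidirectProduct.mul_right, SemidirectProduct.inv_right, SemidirectProduct.right_inl, sectionχq_right,
    one_mul, inv_one, mul_one]

/-- **THE DECK ELEMENT EXISTS at stage 2** (`p ≡ 1 (mod 4)`): there is `ε ∈ Π^tp_X` of `toZ`-degree `0` with
`ε · s_{(√−1)⁻¹}(σ) · ε⁻¹ = s_{√−1}(σ)` for all `σ` — `ε := b^t` with abc-iut-w5-d140's stage-1 deck exponent `t`
(`2κ_{√−1} − 2κ_{(√−1)⁻¹}` is the `χ`-coboundary of `t`). [cite: MochizukiEtTh2009, Def 1.9 p.29] -/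
theorem exists_deck_sectionOfUnitχq (hp : p % 4 = 1) :
    ∃ ε : PiTpχq p 1 2, (ThetaSetting.modelχq p 1 2 even_two).toZ ε = 1 ∧
      ∀ σ : GQp p, ε * sectionOfUnitχq p 1 2 even_two (sqrtNegOneInvUnitχ p hp) σ * ε⁻¹ =
        sectionOfUnitχq p 1 2 even_two (sqrtNegOneUnitχ p hp) σ := by
  obtain ⟨t, ht⟩ := exists_deck_exponent p hp
  refine ⟨SemidirectProduct.inl (bPowGfp t), ?_, fun σ => ?_⟩
  · show (tateTwistData₀ p 1 2).toZ _ = 1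
    rw [GfpTwistData₀.toZ_apply, SemidirectProduct.left_inl, gfpSnd_bPowGfp]
  · refine SemidirectProduct.ext ?_ ?_
    · show ((SemidirectProduct.inl (bPowGfp t) : PiTpχq p 1 2) * sectionχq p 1 2 _
          (kappaUnitχq_sq_mul p 1 2 even_two (sqrtNegOneInvUnitχ p hp)) σ * (SemidirectProduct.inl (bPowGfp t))⁻¹).left =
        (sectionχq p 1 2 _ (kappaUnitχq_sq_mul p 1 2 even_two (sqrtNegOneUnitχ p hp)) σ).left
      rw [inl_bPowGfp_conj_sectionχq_left, sectionχq_left, Pi.mul_apply, Pi.mul_apply, kappaUnitχq_tate_eq,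
        kappaUnitχq_tate_eq, ht σ]
    · show ((SemidirectProduct.inl (bPowGfp t) : PiTpχq p 1 2) * sectionχq p 1 2 _
          (kappaUnitχq_sq_mul p 1 2 even_two (sqrtNegOneInvUnitχ p hp)) σ * (SemidirectProduct.inl (bPowGfp t))⁻¹).right =
        (sectionχq p 1 2 _ (kappaUnitχq_sq_mul p 1 2 even_two (sqrtNegOneUnitχ p hp)) σ).right
      rw [inl_bPowGfp_conj_sectionχq_right, sectionχq_right]

/-- From the section identity to the decomposition groups. [folklore] -/
private theorem map_eq_comap_conj_of_conj_eq_tate {s s' : GQp p →* PiTpχq p 1 2} {ε : PiTpχq p 1 2}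
    (h : ∀ σ : GQp p, ε * s' σ * ε⁻¹ = s σ) (G : Subgroup (GQp p)) :
    G.map s' = (G.map s).comap (MulAut.conj ε).toMonoidHom := by
  ext x
  rw [Subgroup.mem_comap, MulEquiv.coe_toMonoidHom, MulAut.conj_apply]
  constructor
  · rintro ⟨σ, hσ, rfl⟩
    exact ⟨σ, hσ, (h σ).symm⟩
  · rintro ⟨σ, hσ, hx⟩
    refine ⟨σ, hσ, ?_⟩
    rw [← h σ] at hx
    exact mul_left_cancel (mul_right_cancel hx)

/-- **THE DECK RELATION at stage 2**: `D_{τ⁻¹} = D_τ.comap (conj ε)` with `toZ ε = 1` — the data binder `hdeck` of the K2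
deck closers INHABITED at the stage-2 anchored standard datum. [cite: MochizukiEtTh2009, Def 1.9 p.29] -/
theorem exists_deck_modelχq (hp : p % 4 = 1) :
    ∃ ε : (MuTwoSetting.modelχq p 1 2 even_two).PiTemp, (MuTwoSetting.modelχq p 1 2 even_two).toZ ε = 1 ∧
      (anchoredStandardDataχq p hp).tauInv.Dpt =
        (anchoredStandardDataχq p hp).tau.Dpt.comap (MulAut.conj ε).toMonoidHom := by
  obtain ⟨ε, hε, h⟩ := exists_deck_sectionOfUnitχq p hp
  exact ⟨ε, hε, map_eq_comap_conj_of_conj_eq_tate p h _⟩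

/-! ### §6. Thm. 1.10 at the stage-2 record: (i), (ii) and — by the printed route — (i)-UNIQUENESS -/

/-- **[EtTh] Thm. 1.10 (i) and (ii) HOLD at the stage-2 record for `γ = id`** (`p ≡ 1 (mod 4)`): the K2 closer p429827 at
`MuTwoSetting.modelχq p 1 2`, the étale-theta datum `etaleThetaDataχqInr`, the anchored standard datum and Prop. 1.5 (ii)
as a THEOREM. [cite: MochizukiEtTh2009, Thm 1.10 (ii) p.30] -/
theorem modelχq_thm110i_and_ii (hp : p % 4 = 1) :
    ∃ H : Thm110Hypothesis (Mα := MuTwoSetting.modelχq p 1 2 even_two) (Mβ := MuTwoSetting.modelχq p 1 2 even_two)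
        (epsZχq p) (epsZχq p) (ThetaSetting.modelχq p 1 2 even_two).compat (ThetaSetting.modelχq p 1 2 even_two).compat
        (etaleThetaDataχqInr p) (etaleThetaDataχqInr p) (ContinuousMulEquiv.refl _),
      Thm110i H (anchoredStandardDataχq p hp).toStandardData (anchoredStandardDataχq p hp).toStandardData ∧
        Thm110ii H (anchoredStandardDataχq p hp).toStandardData (anchoredStandardDataχq p hp).toStandardData :=
  (MuTwoSetting.modelχq p 1 2 even_two).thm110i_and_ii_refl (modelχq_isAdmissibleEpsZ p)
    (ThetaSetting.modelχq p 1 2 even_two).compat (etaleThetaDataχqInr p) (anchoredStandardDataχq p hp)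
    (prop15ii_etaleThetaDataχqInr p _)

/-- **[EtTh] Thm. 1.10 (i)-UNIQUENESS («up to ±1») HOLDS at the stage-2 record by the PRINTED route r8″** — abc-iut-w5-d140's
`MuTwoSetting.thm110iUnique_anchored_of_deck` (p425484) with its three inputs ALL THEOREMS here: `Prop15ii` (§2),
**`Prop15iii`** (abc-iut-L2-t6's F7q — false at every stage-1 model) and the deck relation (§5). First instance of the typed
F-0513 closer with `Prop15iii` genuinely inhabited. [cite: MochizukiEtTh2009, Thm 1.10 (i) p.29] -/
theorem modelχq_thm110iUnique (hp : p % 4 = 1) :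
    Thm110iUnique (ThetaSetting.modelχq p 1 2 even_two).compat (modelχq_isAdmissibleEpsZ p) (etaleThetaDataχqInr p)
      (anchoredStandardDataχq p hp).toStandardData :=
  MuTwoSetting.thm110iUnique_anchored_of_deck _ (modelχq_isAdmissibleEpsZ p) (etaleThetaDataχqInr p)
    (anchoredStandardDataχq p hp) (prop15ii_etaleThetaDataχqInr p _) (prop15iii_etaleThetaDataχqInr p _)
    (exists_deck_modelχq p hp)

/-- **JOINT SATISFIABILITY at stage 2 (census headline).** For `p ≡ 1 (mod 4)` there are a Def. 1.7 setting `M` whose theta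
setting satisfies `IsEtThOrigin` AND the Tate clause `IsTateOrigin`, an admissible `ε_Z`, an étale-theta datum `E`, an
ANCHORED standard datum `A` with the deck relation, such that `Prop15i ∧ Prop15ii ∧ Prop15iii` hold for `E` at `M.compat` and
`Thm110i ∧ Thm110ii ∧ Thm110iUnique` hold — witness `MuTwoSetting.modelχq p 1 2`, `η̈^Θ := etaDdχq`, `γ = id`.
[cite: MochizukiEtTh2009, Thm 1.10 p.29] -/
theorem _root_.Literature.AnabelianGeometry.EtaleTheta.MuTwoSetting.exists_stage2_model_thm110_with_prop15iii
    (hp : p % 4 = 1) :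
    ∃ (M : MuTwoSetting p) (εZ : M.GtpC) (hZ : M.IsAdmissibleEpsZ εZ) (E : M.toThetaSetting.EtaleThetaData)
      (A : M.AnchoredStandardData E.toKummerData)
      (H : Thm110Hypothesis εZ εZ M.toThetaSetting.compat M.toThetaSetting.compat E E
        (ContinuousMulEquiv.refl (M.dotC εZ))),
      M.toThetaSetting.IsEtThOrigin ∧ M.toThetaSetting.IsTateOrigin ∧
      ThetaSetting.Prop15i E.toKummerData M.toThetaSetting.compat ∧
      ThetaSetting.Prop15ii E.toKummerData M.toThetaSetting.compat ∧
      ThetaSetting.Prop15iii E M.toThetaSetting.compat ∧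
      (∃ ε : M.PiTemp, M.toZ ε = 1 ∧ A.tauInv.Dpt = A.tau.Dpt.comap (MulAut.conj ε).toMonoidHom) ∧
      Thm110i H A.toStandardData A.toStandardData ∧ Thm110ii H A.toStandardData A.toStandardData ∧
      Thm110iUnique M.toThetaSetting.compat hZ E A.toStandardData := by
  obtain ⟨H, h1, h2⟩ := modelχq_thm110i_and_ii p hp
  exact ⟨MuTwoSetting.modelχq p 1 2 even_two, epsZχq p, modelχq_isAdmissibleEpsZ p, etaleThetaDataχqInr p,
    anchoredStandardDataχq p hp, H, ThetaSetting.modelχq_isEtThOrigin p 1 2 even_two, modelχq_isTateOrigin p 1,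
    (prop15i_and_ii_kummerDataχqInr p _).1, prop15ii_etaleThetaDataχqInr p _, prop15iii_etaleThetaDataχqInr p _,
    exists_deck_modelχq p hp, h1, h2, modelχq_thm110iUnique p hp⟩

end Literature.AnabelianGeometry.EtaleTheta.SettingModel

end
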